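import Summits.CriticalPhenomena.PercolationContinuityZ3.Theorems.PercNearOneGluingNoHeavyConstsChainRulePendantU
import Summits.CriticalPhenomena.PercolationContinuityZ3.Theorems.PercNearOneGluingNoHeavyConstsSetMarkerDominance
import Mathlib.LinearAlgebra.Matrix.Determinant.Basic
import HarnessLib
import HarnessLib.Audit.Tags

/-!
# The chain rule for an avoided vertex attached to the named points only: the two remaining 4-point inequalities (THEOREMS)
# (PAPER-2 track (ii): constants of the CSH family)

builds on p205010 (kernel theorem, internal audit signed; external expert review pending).  Support file (`--supports
stmt-CriticalPhenomena-4575`), seat `prim-consts-2` (gen 7); rows A6/A11 of `run/shared/lean/prim/consts/CONSTANTS.md`; memo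
`run/shared/lean/prim/consts/FROM-prim-consts-2-g7-ROW-SPLIT.md` §11.  No definitions, no named facts, no sorries; standard axioms.

THE LOCAL FAMILY (memo §11).  In the chain-minor normal form `D` (`Consts.singleEdgeChainRule_of_chainMinor`, p306944) take the avoided set to be one
vertex `y` whose possible neighbours are `x, u, v, o` (weights `q_x, q_u, q_v, q_o`, arbitrary graph on the other vertices, kernel `k = K_{G−y}`).  Peeling
the edges at `y` (three independent copies, one per column) expands `D(G;{y})` in the trinomial Bernstein basis `∏_t q_t^{k_t}(1−q_t)^{3−k_t}`, and the
64 coefficients collapse (seat computation, toy_profiles.py, exact symbolic) to nonnegative integer combinations of FOUR 4-point polynomials: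
`D₀` (`Consts.chainRule_voAvoid_noTarget`, PROVED p305568), `k(xuv,o)·[k(x,ov)k(xu,v) − k(x,v)k(xu,ov)] ≥ 0` (RR₂), and the two proved here:
* `Consts.avoid_mul_avoid_le_local` — **N₀: `k(x,uv)·k(xu,ov) ≤ k(x,ouv)·k(xu,v)`** (two applications of vdBHK Thm 1.3 given `{x ↮ v}`:
  `1{o ∉ C_x}, 1{u ∉ C_x}` positively correlated (log-supermodularity of the kernel in the target), `1{o ∈ C_x}` and the off-cluster separation
  `1{u ↮ v}` positively correlated (`setSep_offCluster_posCorrelation`));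
* `Consts.chainMinor_uAvoid_noTarget` — **A_D₀: `0 ≤ det[[k(x,u),k(x,uo),k(x,uov)],[1,k(xu,o),k(xu,ov)],[1,k(xuv,o),0]]`**, the chain minor with the first
  row under `x ↮ u` (`= k(xu,ov)[k(x,uo) − k(x,u)k(xuv,o)] − k(x,uov)[k(xu,o) − k(xuv,o)]`): vdBHK Thm 1.3 for the source set `{v,o}` given `{v,o} ↮ x`
  (as in D₀), containment, and the SET-MARKER DOMINANCE lemma `Consts.setMarkerDominance_noAvoid` at `F = 1{u ∈ C_x}`:
  `Cov(1_u, 1_{o∈C_x ∨ v∈C_x})·μ(v↔o, x↮v,o) ≤ Cov(1_u, 1_{o∈C_x})·μ(x↮v,o)`;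
* `Consts.cov_reach_union_eq_avoid` — the covariance with a union event in kernel form.
Consequence (memo §11, the peel identity itself is elementary and not formalised): the single-edge chain rule (and the chain minor) hold for
EVERY avoided vertex attached only to `x, u, v, o`, with arbitrary weights — the full "local family", extending the pendant family of p305368/p305568.
[cite: VandenbergHaggstromKahn2005, Thm. 1.3 (p. 6), Thm. 1.1 (pp. 3–5)] [cite: Grimmett1999, Thm. (2.4) p. 34]
-/

noncomputable section

namespace Summit.CriticalPhenomena.PercolationContinuityZ3.Theorems

open MeasureTheory Set Literature.Probability.LatticeModels Literature.Probability.Percolation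
open scoped Classical

namespace Consts

open LonePortSum LonePortSumGeneral BHK2006 DecisionTree KNPreFKG HullPort

/-- Notation (this file only): the disconnection kernel `𝕂[w](S, T) = μ_w{S ↮ T}`. -/
local notation3 "𝕂[" w "](" S ", " T ")" =>
  MeasureTheory.Measure.real (prodBernoulli w) {ω | ∀ s ∈ S, ∀ t ∈ T, ¬ (openGraph ω).Reachable s t}

variable {V : Type*} [Fintype V]

/-- **The covariance of a connection event with a union of two connection events, in kernel form**:
`μ({x↔u} ∩ ({x↔v} ∪ {x↔o})) − μ{x↔u}·μ({x↔v} ∪ {x↔o}) = K(x,{u,v,o}) − K(x,{u})·K(x,{v,o})`. [folklore] -/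
theorem cov_reach_union_eq_avoid (w : Sym2 V → unitInterval) (x u v o : V) :
    (prodBernoulli w).real (openConn x u ∩ (openConn x v ∪ openConn x o)) -
        (prodBernoulli w).real (openConn x u) * (prodBernoulli w).real (openConn x v ∪ openConn x o : Set (BondConfig V)) =
      𝕂[w](({x} : Set V), ({u, v, o} : Set V)) - 𝕂[w](({x} : Set V), ({u} : Set V)) * 𝕂[w](({x} : Set V), ({v, o} : Set V)) := by
  classical
  set μ := prodBernoulli w with hμ
  have hmeas : ∀ T : Set (BondConfig V), MeasurableSet T := fun _ => MeasurableSet.of_discrete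
  have hsing : {ω : BondConfig V | ∀ s ∈ ({x} : Set V), ∀ t ∈ ({u} : Set V), ¬ (openGraph ω).Reachable s t} =
      (openConn x u)ᶜ := by ext ω; simp [openConn]
  have hpair : {ω : BondConfig V | ∀ s ∈ ({x} : Set V), ∀ t ∈ ({v, o} : Set V), ¬ (openGraph ω).Reachable s t} =
      (openConn x v ∪ openConn x o : Set (BondConfig V))ᶜ := by
    ext ω; simp [openConn]
  have htrip : {ω : BondConfig V | ∀ s ∈ ({x} : Set V), ∀ t ∈ ({u, v, o} : Set V), ¬ (openGraph ω).Reachable s t} =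
      (openConn x u)ᶜ ∩ (openConn x v ∪ openConn x o : Set (BondConfig V))ᶜ := by
    ext ω; simp [openConn]
  rw [htrip, hsing, hpair]
  set U : Set (BondConfig V) := openConn x u with hU
  set Z : Set (BondConfig V) := (openConn x v ∪ openConn x o : Set (BondConfig V)) with hZ
  have h1 : μ.real (U ∩ Z) + μ.real (U \ Z) = μ.real U := measureReal_inter_add_sdiff (hmeas Z)
  have h2 : μ.real (Zᶜ ∩ U) + μ.real (Zᶜ \ U) = μ.real Zᶜ := measureReal_inter_add_sdiff (hmeas U)
  have h3 : μ.real U + μ.real Uᶜ = 1 := by rw [measureReal_add_measureReal_compl (hmeas U), probReal_univ]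
  have h4 : μ.real Z + μ.real Zᶜ = 1 := by rw [measureReal_add_measureReal_compl (hmeas Z), probReal_univ]
  have e1 : U \ Z = Zᶜ ∩ U := by ext ω; simp only [mem_sdiff, mem_inter_iff, mem_compl_iff]; tauto
  have e2 : Zᶜ \ U = Uᶜ ∩ Zᶜ := by ext ω; simp only [mem_sdiff, mem_inter_iff, mem_compl_iff]; tauto
  rw [e1] at h1; rw [e2] at h2
  linear_combination h1 - h2 + μ.real Zᶜ * h3 - μ.real U * h4

/-- **N₀ — `k(x,uv)·k(xu,ov) ≤ k(x,ouv)·k(xu,v)`.**  Given `{x ↮ v}`: the decreasing cluster events `{o ∉ C_x}`, `{u ∉ C_x}` are positively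
correlated (log-supermodularity of the disconnection kernel in the target), and `{o ∈ C_x}` is positively correlated with the off-cluster
separation `{u ↮ v}` (vdBHK Thm 1.3, `setSep_offCluster_posCorrelation`); together with `{xu ↮ ov} ⊆ {x ↮ v, o ∉ C_x, u ↮ v}`.
[cite: VandenbergHaggstromKahn2005, Thm. 1.3 (p. 6), Thm. 1.1 (pp. 3–5)] -/
theorem avoid_mul_avoid_le_local (w : Sym2 V → unitInterval) (x u v o : V) :
    𝕂[w](({x} : Set V), ({u, v} : Set V)) * 𝕂[w](({x, u} : Set V), ({o, v} : Set V)) ≤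
      𝕂[w](({x} : Set V), ({o, u, v} : Set V)) * 𝕂[w](({x, u} : Set V), ({v} : Set V)) := by
  classical
  set μ := prodBernoulli w with hμ
  have hmeas : ∀ T : Set (BondConfig V), MeasurableSet T := fun _ => MeasurableSet.of_discrete
  set D : Set (BondConfig V) := {ω | ∀ t ∈ ({v} : Set V), ¬ (openGraph ω).Reachable x t} with hD
  set U : Set (BondConfig V) := openConn x u with hU
  set O : Set (BondConfig V) := openConn x o with hO
  set B : Set (BondConfig V) := openConn v u with hB
  -- the kernel entries as masses of sub-events of `D`
  have eb : 𝕂[w](({x} : Set V), ({v} : Set V)) = μ.real D := by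
    congr 1; ext ω; simp [hD]
  have eA1 : 𝕂[w](({x} : Set V), ({u, v} : Set V)) = μ.real (D ∩ Uᶜ) := by
    congr 1; ext ω
    simp only [mem_setOf_eq, mem_singleton_iff, forall_eq, mem_insert_iff, forall_eq_or_imp, hD, hU, mem_inter_iff, mem_compl_iff,
      openConn]
    tauto
  have eQ : 𝕂[w](({x} : Set V), ({o, v} : Set V)) = μ.real (D ∩ Oᶜ) := by
    congr 1; ext ω
    simp only [mem_setOf_eq, mem_singleton_iff, forall_eq, mem_insert_iff, forall_eq_or_imp, hD, hO, mem_inter_iff, mem_compl_iff,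
      openConn]
    tauto
  have eP : 𝕂[w](({x} : Set V), ({o, u, v} : Set V)) = μ.real (D ∩ Uᶜ ∩ Oᶜ) := by
    congr 1; ext ω
    simp only [mem_setOf_eq, mem_singleton_iff, forall_eq, mem_insert_iff, forall_eq_or_imp, hD, hU, hO, mem_inter_iff, mem_compl_iff,
      openConn]
    tauto
  have es : 𝕂[w](({x, u} : Set V), ({v} : Set V)) = μ.real (D ∩ Bᶜ) := by
    congr 1; ext ω
    simp only [mem_setOf_eq, mem_singleton_iff, forall_eq, mem_insert_iff, forall_eq_or_imp, hD, hB, mem_inter_iff, mem_compl_iff,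
      openConn]
    exact ⟨fun h => ⟨h.1, fun h' => h.2 h'.symm⟩, fun h => ⟨h.1, fun h' => h.2 h'.symm⟩⟩
  have hsub : {ω : BondConfig V | ∀ s ∈ ({x, u} : Set V), ∀ t ∈ ({o, v} : Set V), ¬ (openGraph ω).Reachable s t} ⊆ D ∩ Oᶜ ∩ Bᶜ := by
    intro ω h
    simp only [mem_setOf_eq, mem_insert_iff, mem_singleton_iff, forall_eq_or_imp, forall_eq] at h
    simp only [hD, hO, hB, mem_inter_iff, mem_compl_iff, mem_setOf_eq, mem_singleton_iff, forall_eq, openConn]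
    exact ⟨⟨h.1.2, h.1.1⟩, fun h' => h.2.2 h'.symm⟩
  have hs'' : 𝕂[w](({x, u} : Set V), ({o, v} : Set V)) ≤ μ.real (D ∩ Oᶜ ∩ Bᶜ) := measureReal_mono hsub
  -- step 1: log-supermodularity in the target: `μ(D ∩ Uᶜ) μ(D ∩ Oᶜ) ≤ μ(D) μ(D ∩ Uᶜ ∩ Oᶜ)`
  have step1 : μ.real (D ∩ Uᶜ) * μ.real (D ∩ Oᶜ) ≤ μ.real D * μ.real (D ∩ Uᶜ ∩ Oᶜ) := by
    have h := real_avoid_insert_mul_le w ({v} : Set V) ({x} : Set V) u o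
    rw [setOf_avoid_comm (insert u {v} : Set V) ({x} : Set V), setOf_avoid_comm (insert o {v} : Set V) ({x} : Set V),
      setOf_avoid_comm ({v} : Set V) ({x} : Set V), setOf_avoid_comm (insert o (insert u {v}) : Set V) ({x} : Set V)] at h
    have e1 : 𝕂[w](({x} : Set V), (insert u {v} : Set V)) = μ.real (D ∩ Uᶜ) := eA1
    have e2 : 𝕂[w](({x} : Set V), (insert o {v} : Set V)) = μ.real (D ∩ Oᶜ) := eQ
    have e3 : 𝕂[w](({x} : Set V), (insert o (insert u {v}) : Set V)) = μ.real (D ∩ Uᶜ ∩ Oᶜ) := eP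
    rw [e1, e2, eb, e3] at h
    exact h
  -- degenerate case `x = v`
  by_cases hxv : x = v
  · have h0 : 𝕂[w](({x} : Set V), ({u, v} : Set V)) = 0 := by
      have : {ω : BondConfig V | ∀ s ∈ ({x} : Set V), ∀ t ∈ ({u, v} : Set V), ¬ (openGraph ω).Reachable s t} = ∅ := by
        ext ω; simp only [mem_setOf_eq, mem_empty_iff_false, iff_false, not_forall, not_not]
        exact ⟨x, rfl, v, by simp, hxv ▸ SimpleGraph.Reachable.refl _⟩
      simp only [this, measureReal_empty]
    rw [h0, zero_mul]
    exact mul_nonneg measureReal_nonneg measureReal_nonneg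
  -- step 2: `1{o ∈ C_x}` and the off-cluster separation `1{u ↮ v}` are positively correlated given `{x ↮ v}`
  have hxX : x ∉ ({v} : Set V) := fun h => hxv (mem_singleton_iff.1 h)
  have step2raw := setSep_offCluster_posCorrelation w x ({v} : Set V) hxX (connIndicatorFn x o) (monotone_connIndicatorFn x o)
    (Bᶜ.indicator 1) (fun ω ω' hle => by
      by_cases h' : ω' ∈ Bᶜ
      · have h : ω ∈ Bᶜ := fun hB' => h' ((isUpperSet_openConn v u) hle hB')
        rw [indicator_of_mem h, indicator_of_mem h', Pi.one_apply, Pi.one_apply]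
      · rw [indicator_of_notMem h']
        exact indicator_nonneg (fun _ _ => zero_le_one) _)
    (fun ω hω => by
      have hns : ¬ (openGraph ω).Reachable x v := hω v rfl
      have key : (ω \ {e | ∃ v' ∈ e, v' = x ∨ ∃ e' ∈ openEdgeCluster ω x, v' ∈ e'}) ∈ B ↔ ω ∈ B :=
        LonePortSumGeneral.reachable_sdiff_bar_iff hns u
      by_cases hb : ω ∈ B
      · rw [indicator_of_notMem (Set.notMem_compl_iff.2 (key.2 hb)), indicator_of_notMem (Set.notMem_compl_iff.2 hb)]
      · rw [indicator_of_mem (Set.mem_compl (fun h => hb (key.1 h))), indicator_of_mem (Set.mem_compl hb), Pi.one_apply,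
          Pi.one_apply])
  simp only [connIndicatorFn_openEdgeCluster] at step2raw
  rw [setIntegral_indicator_one_eq, setIntegral_indicator_one_eq, TripodExchange.setIntegral_indicator_mul_indicator_eq] at step2raw
  -- step2raw : μ(D ∩ O) * μ(D ∩ Bᶜ) ≤ μ(D) * μ(D ∩ (O ∩ Bᶜ))
  change μ.real (D ∩ O) * μ.real (D ∩ Bᶜ) ≤ μ.real D * μ.real (D ∩ (O ∩ Bᶜ)) at step2raw
  have eO : μ.real (D ∩ O) = μ.real D - μ.real (D ∩ Oᶜ) := by
    have h := measureReal_inter_add_sdiff (μ := μ) (s := D) (hmeas O)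
    rw [show D \ O = D ∩ Oᶜ by ext ω; simp only [mem_sdiff, mem_inter_iff, mem_compl_iff]] at h
    linarith
  have eOB : μ.real (D ∩ (O ∩ Bᶜ)) = μ.real (D ∩ Bᶜ) - μ.real (D ∩ Oᶜ ∩ Bᶜ) := by
    have h := measureReal_inter_add_sdiff (μ := μ) (s := D ∩ Bᶜ) (hmeas O)
    rw [show D ∩ Bᶜ ∩ O = D ∩ (O ∩ Bᶜ) by ext ω; simp only [mem_inter_iff, mem_compl_iff]; tauto,
      show (D ∩ Bᶜ) \ O = D ∩ Oᶜ ∩ Bᶜ by ext ω; simp only [mem_sdiff, mem_inter_iff, mem_compl_iff]; tauto] at h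
    linarith
  -- step 2: `μ(D) μ(D ∩ Oᶜ ∩ Bᶜ) ≤ μ(D ∩ Oᶜ) μ(D ∩ Bᶜ)`
  have step2 : μ.real D * μ.real (D ∩ Oᶜ ∩ Bᶜ) ≤ μ.real (D ∩ Oᶜ) * μ.real (D ∩ Bᶜ) := by
    rw [eO, eOB] at step2raw; nlinarith [step2raw]
  -- assemble: `μ(D) · (RHS − LHS) ≥ 0`
  rw [eA1, eP, es]
  have hb0 : 0 ≤ μ.real D := measureReal_nonneg
  have hA1 : 0 ≤ μ.real (D ∩ Uᶜ) := measureReal_nonneg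
  have hBc : 0 ≤ μ.real (D ∩ Bᶜ) := measureReal_nonneg
  have hK2 : 0 ≤ 𝕂[w](({x, u} : Set V), ({o, v} : Set V)) := measureReal_nonneg
  have hmain : μ.real D * (𝕂[w](({x, u} : Set V), ({o, v} : Set V)) * μ.real (D ∩ Uᶜ)) ≤
      μ.real D * (μ.real (D ∩ Uᶜ ∩ Oᶜ) * μ.real (D ∩ Bᶜ)) := by
    have h1 := mul_le_mul_of_nonneg_left hs'' (mul_nonneg hb0 hA1)
    have h2 := mul_le_mul_of_nonneg_left step2 hA1
    have h3 := mul_le_mul_of_nonneg_right step1 hBc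
    nlinarith [h1, h2, h3]
  by_cases hD0 : μ.real D = 0
  · have hA1le : μ.real (D ∩ Uᶜ) ≤ μ.real D := measureReal_mono inter_subset_left
    have hA10 : μ.real (D ∩ Uᶜ) = 0 := le_antisymm (hD0 ▸ hA1le) hA1
    rw [hA10, zero_mul]
    exact mul_nonneg measureReal_nonneg measureReal_nonneg
  · have hDpos : 0 < μ.real D := lt_of_le_of_ne hb0 (Ne.symm hD0)
    have := le_of_mul_le_mul_left hmain hDpos
    linarith [this]

/-- **A_D₀ — the chain minor with the first row under `x ↮ u` (the "pendant at `u`" coefficient of the chain minor).**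
`0 ≤ det[[k(x,u),k(x,uo),k(x,uov)],[1,k(xu,o),k(xu,ov)],[1,k(xuv,o),0]] = k(xu,ov)[k(x,uo) − k(x,u)k(xuv,o)] − k(x,uov)[k(xu,o) − k(xuv,o)]`.
Proof: vdBHK Thm 1.3 for the source set `{v,o}` given `{v,o} ↮ x` (`k(x,vo)[k(xu,o)−k(xuv,o)] ≤ μ(o∈C_v∖C_x)·k(xu,vo)`), containment
`μ(o∈C_v∖C_x) ≤ k(x,o) − k(xuv,o)`, and set-marker dominance `Consts.setMarkerDominance_noAvoid` at `F = 1{u ∈ C_x}`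
(`μ(o∈C_v∖C_x)·[k(x,uov) − k(x,u)k(x,vo)] ≤ k(x,vo)·[k(x,uo) − k(x,u)k(x,o)]`).
[cite: VandenbergHaggstromKahn2005, Thm. 1.3 (p. 6) with Remark 1 after Thm. 1.2 (p. 5)] -/
theorem chainMinor_uAvoid_noTarget (w : Sym2 V → unitInterval) (x u v o : V) :
    0 ≤ Matrix.det !![
      𝕂[w](({x} : Set V), ({u} : Set V)), 𝕂[w](({x} : Set V), ({u, o} : Set V)), 𝕂[w](({x} : Set V), ({u, v, o} : Set V));
      𝕂[w](({x, u} : Set V), (∅ : Set V)), 𝕂[w](({x, u} : Set V), ({o} : Set V)), 𝕂[w](({x, u} : Set V), ({v, o} : Set V));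
      𝕂[w](({x, u, v} : Set V), (∅ : Set V)), 𝕂[w](({x, u, v} : Set V), ({o} : Set V)),
        𝕂[w](({x, u, v} : Set V), ({v, o} : Set V))] := by
  classical
  set μ := prodBernoulli w with hμ
  have hmeas : ∀ T : Set (BondConfig V), MeasurableSet T := fun _ => MeasurableSet.of_discrete
  set a := 𝕂[w](({x} : Set V), ({u} : Set V)) with ha
  set c := 𝕂[w](({x} : Set V), ({o} : Set V)) with hc
  set e := 𝕂[w](({x} : Set V), ({u, o} : Set V)) with he
  set p := 𝕂[w](({x} : Set V), ({v, o} : Set V)) with hp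
  set q := 𝕂[w](({x} : Set V), ({u, v, o} : Set V)) with hq
  set s' := 𝕂[w](({x, u} : Set V), ({v, o} : Set V)) with hs'
  set t := 𝕂[w](({x, u} : Set V), ({o} : Set V)) with ht
  set z := 𝕂[w](({x, u, v} : Set V), ({o} : Set V)) with hz
  -- trivial entries
  have hempty : ∀ S : Set V, 𝕂[w](S, (∅ : Set V)) = 1 := by
    intro S
    have : {ω : BondConfig V | ∀ s'' ∈ S, ∀ t' ∈ (∅ : Set V), ¬ (openGraph ω).Reachable s'' t'} = univ := by ext ω; simp
    rw [this]; simp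
  have hK3 : 𝕂[w](({x, u, v} : Set V), ({v, o} : Set V)) = 0 := by
    have : {ω : BondConfig V | ∀ s'' ∈ ({x, u, v} : Set V), ∀ t' ∈ ({v, o} : Set V), ¬ (openGraph ω).Reachable s'' t'} = ∅ := by
      ext ω
      simp only [mem_setOf_eq, mem_empty_iff_false, iff_false, not_forall, not_not]
      exact ⟨v, by simp, v, by simp, SimpleGraph.Reachable.refl _⟩
    rw [this]; simp
  have hdet : Matrix.det !![a, e, q; 𝕂[w](({x, u} : Set V), (∅ : Set V)), t, s';
      𝕂[w](({x, u, v} : Set V), (∅ : Set V)), z, 𝕂[w](({x, u, v} : Set V), ({v, o} : Set V))] = s' * (e - a * z) - q * (t - z) := by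
    rw [Matrix.det_fin_three]
    simp only [Matrix.of_apply, Matrix.cons_val', Matrix.cons_val_zero, Matrix.cons_val_one, Matrix.cons_val_two,
      Matrix.empty_val', Matrix.cons_val_fin_one, Matrix.head_cons, Matrix.tail_cons, Matrix.head_fin_const, hempty, hK3]
    ring
  rw [hdet]
  -- (0) signs and monotonicity
  have hHarris : ∀ t' : V, 𝕂[w](({x} : Set V), ({u} : Set V)) * 𝕂[w](({x} : Set V), ({t'} : Set V)) ≤
      𝕂[w](({x} : Set V), ({u, t'} : Set V)) := by
    intro t'
    have h := real_avoid_insert_mul_le w (∅ : Set V) ({x} : Set V) u t'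
    have h0 : {ω : BondConfig V | ∀ s'' ∈ (∅ : Set V), ∀ t ∈ ({x} : Set V), ¬ (openGraph ω).Reachable s'' t} = univ := by
      ext ω; simp
    rw [h0, probReal_univ, one_mul, ← Set.singleton_def, ← Set.singleton_def] at h
    rw [setOf_avoid_comm ({x} : Set V) ({u} : Set V), setOf_avoid_comm ({x} : Set V) ({t'} : Set V),
      setOf_avoid_comm ({x} : Set V) ({u, t'} : Set V), show ({u, t'} : Set V) = ({t', u} : Set V) from pair_comm _ _]
    exact h
  have hco : 0 ≤ e - a * c := by have := hHarris o; rw [← he, ← ha, ← hc] at this; linarith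
  have hzc : z ≤ c := by
    rw [hz, hc]; exact measureReal_mono (fun ω h s'' hs'' t' ht' => h s'' (by
      rw [mem_singleton_iff] at hs''; subst hs''; exact mem_insert _ _) t' ht')
  have hqp : q ≤ p := by
    rw [hq, hp]; exact measureReal_mono (fun ω h s'' hs'' t' ht' => h s'' hs'' t' (mem_insert_of_mem _ ht'))
  have ha0 : 0 ≤ a := measureReal_nonneg
  have hs0 : 0 ≤ s' := measureReal_nonneg
  have hq0 : 0 ≤ q := measureReal_nonneg
  have hp0 : 0 ≤ p := measureReal_nonneg
  -- (1) vdBHK Thm 1.3 for the source set `{v, o}` given `{v, o} ↮ x`: `p (t − z) ≤ m s'`, and containment `m ≤ c − z`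
  set D : Set (BondConfig V) := {ω | ∀ s'' ∈ ({v, o} : Set V), ∀ t' ∈ ({x} : Set V), ¬ (openGraph ω).Reachable s'' t'} with hD
  set W : Set (BondConfig V) := {ω | ∃ s'' ∈ ({v} : Set V), ∃ a' ∈ ({o} : Set V), (openGraph ω).Reachable s'' a'} with hW
  set U : Set (BondConfig V) := {ω | ∃ s'' ∈ ({v, o} : Set V), ∃ a' ∈ ({u} : Set V), (openGraph ω).Reachable s'' a'} with hU
  have key := real_avoid_conn_mul_conn_le w ({v, o} : Set V) ({x} : Set V) (S₁ := {v}) (S₂ := {v, o})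
    (by intro a' ha'; rw [mem_singleton_iff] at ha'; subst ha'; exact mem_insert _ _) subset_rfl ({o} : Set V) ({u} : Set V)
  change μ.real (D ∩ W) * μ.real (D ∩ U) ≤ μ.real D * μ.real (D ∩ (W ∩ U)) at key
  have hDp : μ.real D = p := by rw [hp, hD, setOf_avoid_comm]
  have hDU : μ.real (D \ U) = s' := by
    rw [hs']; congr 1; ext ω
    simp only [hD, hU, mem_sdiff, mem_setOf_eq, mem_insert_iff, mem_singleton_iff, forall_eq_or_imp, forall_eq, exists_eq_or_imp,
      exists_eq_left, not_or]
    constructor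
    · rintro ⟨⟨hvx, hox⟩, hvu, hou⟩
      exact ⟨⟨fun h => hvx h.symm, fun h => hox h.symm⟩, ⟨fun h => hvu h.symm, fun h => hou h.symm⟩⟩
    · rintro ⟨⟨hxv', hxo⟩, huv, huo⟩
      exact ⟨⟨fun h => hxv' h.symm, fun h => hxo h.symm⟩, fun h => huv h.symm, fun h => huo h.symm⟩
  have hDWU : μ.real ((D ∩ W) \ U) = t - z := by
    have hsub : {ω : BondConfig V | ∀ s'' ∈ ({x, u, v} : Set V), ∀ t' ∈ ({o} : Set V), ¬ (openGraph ω).Reachable s'' t'} ⊆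
        {ω : BondConfig V | ∀ s'' ∈ ({x, u} : Set V), ∀ t' ∈ ({o} : Set V), ¬ (openGraph ω).Reachable s'' t'} := by
      intro ω h; simp only [mem_setOf_eq] at h ⊢
      exact fun s'' hs'' t' ht' => h s'' (by simp only [mem_insert_iff, mem_singleton_iff] at hs'' ⊢; tauto) t' ht'
    have hdiff : {ω : BondConfig V | ∀ s'' ∈ ({x, u} : Set V), ∀ t' ∈ ({o} : Set V), ¬ (openGraph ω).Reachable s'' t'} \
        {ω : BondConfig V | ∀ s'' ∈ ({x, u, v} : Set V), ∀ t' ∈ ({o} : Set V), ¬ (openGraph ω).Reachable s'' t'} = (D ∩ W) \ U := by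
      ext ω
      simp only [mem_sdiff, mem_setOf_eq, mem_insert_iff, mem_singleton_iff, forall_eq_or_imp, forall_eq, hD, hW, hU,
        mem_inter_iff, exists_eq_or_imp, exists_eq_left, not_or]
      constructor
      · rintro ⟨⟨hxo, huo⟩, h2⟩
        have hvo : (openGraph ω).Reachable v o := by
          by_contra hvo; exact h2 ⟨hxo, huo, hvo⟩
        exact ⟨⟨⟨fun hvx => hxo (hvx.symm.trans hvo), fun hox => hxo hox.symm⟩, hvo⟩,
          fun hvu => huo (hvu.symm.trans hvo), fun hou => huo hou.symm⟩
      · rintro ⟨⟨⟨hvx, hox⟩, hvo⟩, hvu, hou⟩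
        exact ⟨⟨fun hxo => hox hxo.symm, fun huo => hou huo.symm⟩, fun h => h.2.2 hvo⟩
    rw [ht, hz, ← measureReal_sdiff hsub (hmeas _), hdiff]
  have hDW : μ.real (D ∩ W) ≤ c - z := by
    have hsub : {ω : BondConfig V | ∀ s'' ∈ ({x, u, v} : Set V), ∀ t' ∈ ({o} : Set V), ¬ (openGraph ω).Reachable s'' t'} ⊆
        {ω : BondConfig V | ∀ s'' ∈ ({x} : Set V), ∀ t' ∈ ({o} : Set V), ¬ (openGraph ω).Reachable s'' t'} := by
      intro ω h; simp only [mem_setOf_eq] at h ⊢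
      exact fun s'' hs'' t' ht' => h s'' (by simp only [mem_insert_iff, mem_singleton_iff] at hs'' ⊢; tauto) t' ht'
    have hsub2 : D ∩ W ⊆ {ω : BondConfig V | ∀ s'' ∈ ({x} : Set V), ∀ t' ∈ ({o} : Set V), ¬ (openGraph ω).Reachable s'' t'} \
        {ω : BondConfig V | ∀ s'' ∈ ({x, u, v} : Set V), ∀ t' ∈ ({o} : Set V), ¬ (openGraph ω).Reachable s'' t'} := by
      rintro ω ⟨hDω, hWω⟩
      simp only [hD, hW, mem_setOf_eq, mem_insert_iff, mem_singleton_iff, forall_eq_or_imp, forall_eq, exists_eq_left] at hDω hWω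
      simp only [mem_sdiff, mem_setOf_eq, mem_insert_iff, mem_singleton_iff, forall_eq_or_imp, forall_eq]
      exact ⟨fun hxo => hDω.1 (hWω.trans hxo.symm), fun h => h.2.2 hWω⟩
    rw [hc, hz, ← measureReal_sdiff hsub (hmeas _)]
    exact measureReal_mono hsub2
  have e1 : μ.real ((D ∩ W) \ U) = μ.real (D ∩ W) - μ.real (D ∩ (W ∩ U)) := by
    have h := measureReal_inter_add_sdiff (μ := μ) (s := D ∩ W) (hmeas U)
    rw [show D ∩ W ∩ U = D ∩ (W ∩ U) from inter_assoc _ _ _] at h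
    linarith
  have e2 : μ.real (D \ U) = μ.real D - μ.real (D ∩ U) := by
    have h := measureReal_inter_add_sdiff (μ := μ) (s := D) (hmeas U)
    linarith
  set m := μ.real (D ∩ W) with hm
  have hm0 : 0 ≤ m := measureReal_nonneg
  have hineq : p * (t - z) ≤ m * s' := by
    rw [← hDp, ← hDWU, ← hDU, e1, e2]
    nlinarith [key, (measureReal_nonneg : 0 ≤ μ.real D), hm0]
  -- (2) set-marker dominance at `F = 1{u ∈ C_x}`: `m (q − a p) ≤ p (e − a c)`; degenerate placements first
  by_cases hxv : x = v
  · have hp0' : p = 0 := by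
      have : {ω : BondConfig V | ∀ s'' ∈ ({x} : Set V), ∀ t' ∈ ({v, o} : Set V), ¬ (openGraph ω).Reachable s'' t'} = ∅ := by
        ext ω; simp only [mem_setOf_eq, mem_empty_iff_false, iff_false, not_forall, not_not]
        exact ⟨x, rfl, v, by simp, hxv ▸ SimpleGraph.Reachable.refl _⟩
      rw [hp, this]; simp
    have hq0' : q = 0 := le_antisymm (hp0' ▸ hqp) hq0
    rw [hq0', zero_mul, sub_zero]
    have haz : 0 ≤ e - a * z := by linarith [hco, mul_le_mul_of_nonneg_left hzc ha0]
    exact mul_nonneg hs0 haz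
  by_cases hxo : x = o
  · have hc0 : c = 0 := by
      have : {ω : BondConfig V | ∀ s'' ∈ ({x} : Set V), ∀ t' ∈ ({o} : Set V), ¬ (openGraph ω).Reachable s'' t'} = ∅ := by
        ext ω; simp only [mem_setOf_eq, mem_empty_iff_false, iff_false, not_forall, not_not]
        exact ⟨x, rfl, o, rfl, hxo ▸ SimpleGraph.Reachable.refl _⟩
      rw [hc, this]; simp
    have hpc : p ≤ c := by
      rw [hp, hc]; exact measureReal_mono (fun ω h s'' hs'' t' ht' => h s'' hs'' t' (mem_insert_of_mem _ ht'))
    have hp0' : p = 0 := le_antisymm (hc0 ▸ hpc) hp0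
    have hq0' : q = 0 := le_antisymm (hp0' ▸ hqp) hq0
    rw [hq0', zero_mul, sub_zero]
    have haz : 0 ≤ e - a * z := by linarith [hco, mul_le_mul_of_nonneg_left hzc ha0]
    exact mul_nonneg hs0 haz
  have mdl := setMarkerDominance_noAvoid w x v o hxv hxo (connIndicatorFn x u) (monotone_connIndicatorFn x u)
    (fun C => by unfold connIndicatorFn; split_ifs <;> norm_num)
  simp only [connIndicatorFn_openEdgeCluster, integral_indicator_one (hmeas _)] at mdl
  rw [measureReal_restrict_apply (hmeas _), measureReal_restrict_apply (hmeas _)] at mdl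
  rw [cov_reach_union_eq_avoid w x u v o, cov_reach_eq_avoid w x u o] at mdl
  have hN : μ.real ((openConn x v : Set (BondConfig V))ᶜ ∩ (openConn x o : Set (BondConfig V))ᶜ) = p := by
    rw [hp]; congr 1; ext ω; simp [openConn]
  have hNW : μ.real ((openConn x v : Set (BondConfig V))ᶜ ∩ (openConn x o : Set (BondConfig V))ᶜ ∩ openConn v o) = m := by
    rw [hm]; congr 1; ext ω
    simp only [hD, hW, mem_inter_iff, mem_compl_iff, mem_setOf_eq, mem_insert_iff, mem_singleton_iff, forall_eq_or_imp, forall_eq,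
      exists_eq_left, openConn]
    constructor
    · rintro ⟨⟨hxv', hxo'⟩, hvo⟩; exact ⟨⟨fun h => hxv' h.symm, fun h => hxo' h.symm⟩, hvo⟩
    · rintro ⟨⟨hvx, hox⟩, hvo⟩; exact ⟨⟨fun h => hvx h.symm, fun h => hox h.symm⟩, hvo⟩
  rw [hN, hNW] at mdl
  -- mdl : m * (q - a * p) ≤ p * (e - a * c)
  -- (3) assemble: `p · [s'(e − a z) − q(t − z)] ≥ s' p a (c − z − m) ≥ 0`
  have hmain : 0 ≤ p * (s' * (e - a * z) - q * (t - z)) := by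
    have h1 : q * (p * (t - z)) ≤ q * (m * s') := mul_le_mul_of_nonneg_left hineq hq0
    have h2 : s' * (m * (q - a * p)) ≤ s' * (p * (e - a * c)) := mul_le_mul_of_nonneg_left mdl hs0
    have h3 : 0 ≤ s' * p * a * (c - z - m) := by
      have : 0 ≤ c - z - m := by linarith [hDW]
      exact mul_nonneg (mul_nonneg (mul_nonneg hs0 hp0) ha0) this
    have expand : p * (s' * (e - a * z) - q * (t - z)) =
        (q * (m * s') - q * (p * (t - z))) + (s' * (p * (e - a * c)) - s' * (m * (q - a * p))) + s' * p * a * (c - z - m) := by ring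
    rw [expand]
    linarith [h1, h2, h3]
  by_cases hpz : p = 0
  · have hq0' : q = 0 := le_antisymm (hpz ▸ hqp) hq0
    rw [hq0', zero_mul, sub_zero]
    have haz : 0 ≤ e - a * z := by linarith [hco, mul_le_mul_of_nonneg_left hzc ha0]
    exact mul_nonneg hs0 haz
  · have hppos : 0 < p := lt_of_le_of_ne hp0 (Ne.symm hpz)
    exact nonneg_of_mul_nonneg_right hmain hppos

end Consts

end Summit.CriticalPhenomena.PercolationContinuityZ3.Theorems

end
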